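import Mathlib
import Literature.Analysis.OperatorTheory.SchurComplementCount
import Literature.Analysis.OperatorTheory.SchurComplementPolynomialBound
import HarnessLib

/-!
# EDSchurPoly — the linear-algebra soundness of the E-D-2″ certificate (R3 design, pub-hubbard r3)

HONEST FRAMING: ladder R1–R4 with certified numbers; no claim on H/H₀. This file records, as named
`Prop`s with their proofs, the two linear-algebra facts the ED inertia certificate "E-D-2″" of
`pub-hubbard-r3/EFFICIENCY-ED2p.md` relies on (one-sided Chebyshev/polynomial Schur bound + deflated count).
Both are now theorems of `Literature.Analysis.OperatorTheory.SchurComplementPolynomialBound`; nothing here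
is about fermions. Convention as in `Literature.Analysis.OperatorTheory.SchurComplementCount`: the FREE
block `A` (= the high-double-occupancy corner of `H_b − ρ`, large, sparse, analytically `⪰ c•1`) first, the
PINNED block `D` (= the low corner, small, dense) second; Schur complement `D − Bᵀ A⁻¹ B`.
The many-body input (the corner constant `c = U(d_max+1) + λ_min(T|sector) − ρ`, Ky Fan) is NOT in this
file; at `L = 4`, `(N↑,N↓) = (7,7)` its free-fermion value is `λ_min(T) = −24` (`t′ = 0`) / `−26` (`t′ = −1/4`)
(exact one-body spectrum of the 4×4 torus; `pub-hubbard-r3/census/schur_sizing.json`).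
-/

namespace Summit.HubbardSuperconductivity.HubbardLadder.EDSchurPoly

open Matrix Polynomial Literature.Analysis.OperatorTheory

variable (m n : Type) [Fintype m] [Fintype n] [DecidableEq m]

/-- T7.4a: one-sided polynomial bound for the Schur complement. If `c•1 ⪯ A ⪯ cmax•1` with `0 < c` and
the real polynomial `p` satisfies `1/x ≤ p(x)` on `[c, cmax]`, then
`yᵀ(D − Bᵀ p(A) B)y ≤ yᵀ(D − Bᵀ A⁻¹ B)y` for every `y`. [folklore] -/
def SchurPolyLowerBound : Prop :=
  ∀ (A : Matrix m m ℝ) (B : Matrix m n ℝ) (D : Matrix n n ℝ) (c cmax : ℝ) (p : ℝ[X]),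
    0 < c → (A - c • (1 : Matrix m m ℝ)).PosSemidef → (cmax • (1 : Matrix m m ℝ) - A).PosSemidef →
    (∀ x ∈ Set.Icc c cmax, 1 / x ≤ p.eval x) →
    ∀ y : n → ℝ, y ⬝ᵥ ((D - Bᵀ * (aeval A p) * B) *ᵥ y) ≤ y ⬝ᵥ ((D - Bᵀ * A⁻¹ * B) *ᵥ y)

/-- T7.4a holds (`Literature.Analysis.OperatorTheory.schur_poly_dotProduct_le`). [folklore] -/
theorem schurPolyLowerBound_holds : SchurPolyLowerBound m n :=
  fun A B D c cmax p hc hAc hAcmax hp y => schur_poly_dotProduct_le A B D c cmax p hc hAc hAcmax hp y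

/-- T7.4b: the certificate theorem. Corner enclosure + polynomial inequality + ONE verified positive
semidefiniteness check of the explicit dense matrix `D − Bᵀ p(A) B + Σ_j t_j q_j q_jᵀ` (deflation by `k`
vectors) ⇒ the block form `[[A, B], [Bᵀ, D]]` is nonnegative on `{q_j ⬝ y = 0 ∀ j}` (codimension `≤ k`),
i.e. the block has at most `k` eigenvalues below the shift already subtracted. [cite: Haynsworth1968, Thm 1] -/
def SchurPolyCountCert : Prop :=
  ∀ (k : ℕ) (A : Matrix m m ℝ) (B : Matrix m n ℝ) (D : Matrix n n ℝ) (c cmax : ℝ) (p : ℝ[X])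
    (t : Fin k → ℝ) (q : Fin k → n → ℝ),
    0 < c → (A - c • (1 : Matrix m m ℝ)).PosSemidef → (cmax • (1 : Matrix m m ℝ) - A).PosSemidef →
    (∀ x ∈ Set.Icc c cmax, 1 / x ≤ p.eval x) →
    (D - Bᵀ * (aeval A p) * B + ∑ j, t j • vecMulVec (q j) (q j)).PosSemidef →
    ∀ (x : m → ℝ) (y : n → ℝ), (∀ j, q j ⬝ᵥ y = 0) →
      0 ≤ (Sum.elim x y) ⬝ᵥ (fromBlocks A B Bᵀ D *ᵥ (Sum.elim x y))

/-- T7.4b holds (`Literature.Analysis.OperatorTheory.fromBlocks_dotProduct_nonneg_of_schur_poly_cert`).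
[cite: Haynsworth1968, Thm 1] -/
theorem schurPolyCountCert_holds : SchurPolyCountCert m n :=
  fun _k A B D c cmax p t q hc hAc hAcmax hp hcert x y hy =>
    fromBlocks_dotProduct_nonneg_of_schur_poly_cert A B D c cmax p t q hc hAc hAcmax hp hcert x y hy

end Summit.HubbardSuperconductivity.HubbardLadder.EDSchurPoly
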